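import Summits.RiemannHypothesis.RiemannHypothesis.Theorems.TiltedLandingLaw421R3Hurwitz
import Summits.RiemannHypothesis.RiemannHypothesis.Theorems.TiltedLandingLaw421R3ClusterStep
import Summits.RiemannHypothesis.RiemannHypothesis.Theorems.TiltedLandingLaw421R3ClusterQ

/-! # TiltedLandingLaw421R3RealCrit — W-08 SUCC^B, door (v′): THE REAL PIGEONHOLE `RealCritBoundSig` PROVED (C4 «kernel desk» rh-idea-6 g29)
C1's cluster door (`ClusterQ-v2` 01d45b5d, to land as `…R3ClusterQ`; director (CA381)(2)) hangs on ONE open socket, the real pigeonhole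
`RealCritBoundSig`: at a non-Ready′ level `j`, on an in-range real slice `(a − ρ, a + ρ)` (`|a − x₀| + ρ < (j+3)R/2`), the REAL zeros of `f⁽ʲ⁺¹⁾`
counted with multiplicity number at most the real zeros of `f⁽ʲ⁾` (with multiplicity) PLUS ONE. This file proves it from tree facts only, in the door's own
currency `∑ᶠ z ∈ ball a ρ ∩ {Im z = 0}, analyticOrderNatAt _ z`, so that in (or after) `…R3ClusterQ` the socket closes by the one-liner
`theorem realCritBoundSig_holds : RealCritBoundSig := fun η f x₀ s hmax R Hs B hE j v a ρ hne hnr hr => RhW08.RealCrit.realCritBound hE hne hnr hr`.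
v2 (this file): the tree now carries `…R3ClusterQ.lean` = C1's ClusterQ-**v1** (117d9505, landed 12:01Z by sw-alpha g20), whose counting currency is
`zcountReal g a ρ := ∑ᶠ u ∈ {u | g u = 0 ∧ ‖u − a‖ < ρ ∧ u.im = 0}, ((analyticOrderAt g u).toNat : ℝ)` (NOT v2's `Metric.ball ∩ {im = 0}` / `analyticOrderNatAt` / `ℕ`-cast
currency that §1–§3 below and C3's `Dominated-v3/v4` were written in). §4 therefore adds the kernel BRIDGES between the two currencies for entire `g`
(`finite_inter_support_orderNat`, `finsum_toNat_eq_cast`, `zcount_eq_finsum`, `zcountReal_eq_finsum` — usable by C1's v2 §6 Rouché count and by C3 as well) and CLOSES THE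
TREE SOCKET BY NAME: `realCritBoundSig_holds : RhW08.ClusterQ.RealCritBoundSig`, plus the door modulo the count socket `clusterLawQ_of_count :
RhW08.ClusterQ.ClusterCountSig → RhW08.ClusterQ.ClusterLawQ` (= tree `clusterLawQ_of_count_realBound _ realCritBoundSig_holds`).
PROOF (slot pigeonhole): write `G = f⁽ʲ⁾`, `T` = real zeros of `G` in the slice (teeth), `C` = real zeros of `G′` there. (i) At a `μ`-fold tooth `G′` has order
`μ − 1` (Mathlib `AnalyticAt.analyticOrderAt_deriv_add_one`). (ii) Off the teeth a real critical point `c` is SIMPLE at a non-Ready′ level: `G c ≠ 0`, `G′ c = 0`,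
`G″ c = 0` would be an NL event `0 ≤ G·G″` in range (`TiltReady`), so `G″ c ≠ 0` and the order is `1` (`analyticOrderAt_eq_one_of_zero_deriv_ne_zero`).
(iii) Two off-teeth critical points in one tooth-free slot are forbidden (`RhW08.Hurwitz.readyR2_of_two_crit`), so `c ↦ #{teeth left of c}` is STRICTLY
monotone on the off-teeth critical points, an injection into `{0, …, #T}`: at most `#T + 1` of them. Total: `Σ_T (μ − 1) + (#T + 1) = Σ_T μ + 1`.
CONTENT: §1 analytic-order facts for entire functions (`analyticOrderAt_ne_top_of_entire`, `analyticOrderNatAt_ne_zero_of_entire`,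
`analyticOrderNatAt_deriv_add_one_of_entire`, `analyticOrderNatAt_eq_one_of_simple`); §2 the abstract pigeonhole `finsum_order_deriv_le` (entire `G ≠ 0`, a
slot hypothesis and a simplicity hypothesis on the slice ⇒ the count inequality in `ℕ`); §3 the frame theorems `realCritBound_of_real` / `realCritBound`
(non-Ready′ supplies both hypotheses). SUPPORT for crux `TiltedLandingLaw421` (stmt-RiemannHypothesis-24774), `--supports … --as helper` only; sorry-free.
Nothing here bears on the truth of RH; RH is NOT proved; 24774 OPEN. -/

namespace RhW08.RealCrit

open Complex Set Metric Filter Topology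
open Literature.Analysis.Complex
open RhIdea6.G17.W07C7 RhIdea6.G17.W07C7.Rev6 RhIdea6.G18.W07C8.Law421BirthS RhIdea6.G19.W07C11.Seam
open RhIdea6.G20.W07C12.Frac RhIdea6.G20.W07C12.StColP RhW07.C12.FieldSplit RhIdea6.G21.W07C13.TentMax
open RhW07.C14.TwoSided RhW07.C14.Classes RhW07.C14.Lineage RhW07.C14.Booking
open RhW08.Round1 RhW08.StSwap RhW08.Round2 RhW08.QuadW RhW08.Hurwitz

/-! ## §1 analytic-order facts for entire functions -/

/-- (K) §1 an entire `G ≢ 0` is nowhere locally zero: its analytic order is finite everywhere. -/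
theorem analyticOrderAt_ne_top_of_entire {G : ℂ → ℂ} (hG : Differentiable ℂ G) (hne : G ≠ 0) (z : ℂ) : analyticOrderAt G z ≠ ⊤ := by
  intro htop
  have huniv : AnalyticOnNhd ℂ G Set.univ := fun w _ => hG.analyticAt w
  have hall := huniv.eqOn_zero_of_preconnected_of_eventuallyEq_zero isPreconnected_univ (Set.mem_univ z)
    (analyticOrderAt_eq_top.mp htop)
  exact hne (funext fun w => hall (Set.mem_univ w))

/-- (K) §1 at a zero of an entire `G ≢ 0` the (ℕ-valued) analytic order is non-zero. -/
theorem analyticOrderNatAt_ne_zero_of_entire {G : ℂ → ℂ} (hG : Differentiable ℂ G) (hne : G ≠ 0) {z : ℂ} (hz : G z = 0) :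
    analyticOrderNatAt G z ≠ 0 := by
  have h0 : analyticOrderAt G z ≠ 0 := by
    rw [Ne, (hG.analyticAt z).analyticOrderAt_eq_zero]
    exact fun h => h hz
  intro hN
  rw [analyticOrderNatAt, ENat.toNat_eq_zero] at hN
  rcases hN with h | h
  · exact h0 h
  · exact analyticOrderAt_ne_top_of_entire hG hne z h

/-- ★ (K) §1 **ORDER OF THE DERIVATIVE AT A ZERO**: for entire `G ≢ 0` and `G z = 0`, `ord(G′, z) + 1 = ord(G, z)` (Mathlib
`AnalyticAt.analyticOrderAt_deriv_add_one`, cast to `ℕ`). -/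
theorem analyticOrderNatAt_deriv_add_one_of_entire {G : ℂ → ℂ} (hG : Differentiable ℂ G) (hne : G ≠ 0) {z : ℂ} (hz : G z = 0) :
    analyticOrderNatAt (deriv G) z + 1 = analyticOrderNatAt G z := by
  have han : AnalyticAt ℂ G z := hG.analyticAt z
  have key := han.analyticOrderAt_deriv_add_one
  have hfun : (fun w => G w - G z) = G := by
    funext w
    rw [hz, sub_zero]
  rw [hfun] at key
  obtain ⟨n, hn⟩ := ENat.ne_top_iff_exists.mp (analyticOrderAt_ne_top_of_entire hG hne z)
  rw [← hn] at key
  have hd : analyticOrderAt (deriv G) z ≠ ⊤ := by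
    intro ht
    rw [ht] at key
    simp at key
  obtain ⟨m, hm⟩ := ENat.ne_top_iff_exists.mp hd
  rw [← hm] at key
  have hmn : m + 1 = n := by exact_mod_cast key
  have e1 : analyticOrderNatAt (deriv G) z = m := by simp [analyticOrderNatAt, ← hm]
  have e2 : analyticOrderNatAt G z = n := by simp [analyticOrderNatAt, ← hn]
  rw [e1, e2]
  exact hmn

/-- (K) §1 a SIMPLE zero has (ℕ-valued) analytic order `1`. -/
theorem analyticOrderNatAt_eq_one_of_simple {G : ℂ → ℂ} {z : ℂ} (han : AnalyticAt ℂ G z) (hz : G z = 0) (hd : deriv G z ≠ 0) :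
    analyticOrderNatAt G z = 1 := by
  have h1 := han.analyticOrderAt_eq_one_of_zero_deriv_ne_zero hz hd
  simp [analyticOrderNatAt, h1]

/-! ## §2 the abstract slot pigeonhole -/

/-- ★★★ (K) §2 **THE SLOT PIGEONHOLE**: `G` entire, `G ≢ 0`; on the real slice of `ball a ρ`: (slot) between two real critical points off the zeros
of `G` there is a real zero of `G`; (simple) a real critical point off the zeros of `G` is a simple zero of `G′`. THEN the real zeros of `G′` in the slice,
with multiplicity, number at most those of `G` plus one. -/
theorem finsum_order_deriv_le {G : ℂ → ℂ} (hG : Differentiable ℂ G) (hne : G ≠ 0) {a ρ : ℝ}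
    (hslot : ∀ c₁ c₂ : ℂ, c₁ ∈ ball (a : ℂ) ρ → c₁.im = 0 → c₂ ∈ ball (a : ℂ) ρ → c₂.im = 0 → c₁.re < c₂.re →
      deriv G c₁ = 0 → deriv G c₂ = 0 → G c₁ ≠ 0 → G c₂ ≠ 0 →
      ∃ t : ℂ, t ∈ ball (a : ℂ) ρ ∧ t.im = 0 ∧ G t = 0 ∧ c₁.re < t.re ∧ t.re < c₂.re)
    (hsimple : ∀ c : ℂ, c ∈ ball (a : ℂ) ρ → c.im = 0 → deriv G c = 0 → G c ≠ 0 → deriv (deriv G) c ≠ 0) :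
    (∑ᶠ z ∈ ball (a : ℂ) ρ ∩ {z : ℂ | z.im = 0}, analyticOrderNatAt (deriv G) z)
      ≤ (∑ᶠ z ∈ ball (a : ℂ) ρ ∩ {z : ℂ | z.im = 0}, analyticOrderNatAt G z) + 1 := by
  classical
  by_cases hG₁ : deriv G = 0
  · -- `G` is constant: `G′ ≡ 0` has order `⊤`, i.e. `ℕ`-order `0`, everywhere
    have h0 : ∀ z : ℂ, analyticOrderNatAt (deriv G) z = 0 := by
      intro z
      have : analyticOrderAt (deriv G) z = ⊤ := analyticOrderAt_eq_top.mpr (Filter.Eventually.of_forall fun w => by rw [hG₁]; rfl)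
      simp [analyticOrderNatAt, this]
    have : (∑ᶠ z ∈ ball (a : ℂ) ρ ∩ {z : ℂ | z.im = 0}, analyticOrderNatAt (deriv G) z) = 0 := by
      rw [finsum_mem_congr rfl (fun z _ => h0 z)]
      simp
    rw [this]
    exact Nat.zero_le _
  have hG₁d : Differentiable ℂ (deriv G) := hG.deriv
  -- the finite supports on the slice
  have hZ : (ball (a : ℂ) ρ ∩ {z : ℂ | z.im = 0} ∩ Function.support (analyticOrderNatAt G)).Finite := by
    refine (finite_zeros_closedBall_of_entire hG hne (a : ℂ) ρ).subset ?_
    intro u hu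
    exact ⟨ball_subset_closedBall hu.1.1, apply_eq_zero_of_analyticOrderNatAt_ne_zero hu.2⟩
  have hZ₁ : (ball (a : ℂ) ρ ∩ {z : ℂ | z.im = 0} ∩ Function.support (analyticOrderNatAt (deriv G))).Finite := by
    refine (finite_zeros_closedBall_of_entire hG₁d hG₁ (a : ℂ) ρ).subset ?_
    intro u hu
    exact ⟨ball_subset_closedBall hu.1.1, apply_eq_zero_of_analyticOrderNatAt_ne_zero hu.2⟩
  rw [← finsum_mem_inter_support (analyticOrderNatAt (deriv G)) (ball (a : ℂ) ρ ∩ {z : ℂ | z.im = 0}),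
    ← finsum_mem_inter_support (analyticOrderNatAt G) (ball (a : ℂ) ρ ∩ {z : ℂ | z.im = 0}),
    finsum_mem_eq_finite_toFinset_sum _ hZ₁, finsum_mem_eq_finite_toFinset_sum _ hZ]
  set T : Finset ℂ := hZ.toFinset with hT
  set C : Finset ℂ := hZ₁.toFinset with hC
  have hmemT : ∀ z : ℂ, z ∈ T ↔ (z ∈ ball (a : ℂ) ρ ∧ z.im = 0) ∧ analyticOrderNatAt G z ≠ 0 := by
    intro z
    rw [hT, Set.Finite.mem_toFinset]
    rfl
  have hmemC : ∀ z : ℂ, z ∈ C ↔ (z ∈ ball (a : ℂ) ρ ∧ z.im = 0) ∧ analyticOrderNatAt (deriv G) z ≠ 0 := by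
    intro z
    rw [hC, Set.Finite.mem_toFinset]
    rfl
  -- split the critical set into teeth and off-teeth points
  rw [← Finset.sum_filter_add_sum_filter_not C (fun z => G z = 0)]
  -- (A) at the teeth: `ord(G′) = ord(G) − 1`, and the multiple teeth lie in `T`
  have hA : (∑ z ∈ C.filter (fun z => G z = 0), analyticOrderNatAt (deriv G) z)
      ≤ ∑ z ∈ T, (analyticOrderNatAt G z - 1) := by
    have hsub : C.filter (fun z => G z = 0) ⊆ T := by
      intro z hz
      rw [Finset.mem_filter] at hz
      exact (hmemT z).mpr ⟨((hmemC z).mp hz.1).1, analyticOrderNatAt_ne_zero_of_entire hG hne hz.2⟩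
    have heq : ∀ z ∈ C.filter (fun z => G z = 0), analyticOrderNatAt (deriv G) z = analyticOrderNatAt G z - 1 := by
      intro z hz
      rw [Finset.mem_filter] at hz
      have := analyticOrderNatAt_deriv_add_one_of_entire hG hne hz.2
      omega
    rw [Finset.sum_congr rfl heq]
    exact Finset.sum_le_sum_of_subset hsub
  -- (B) off the teeth: every point is a SIMPLE zero of `G′`
  have hB : (∑ z ∈ C.filter (fun z => ¬ G z = 0), analyticOrderNatAt (deriv G) z) = (C.filter (fun z => ¬ G z = 0)).card := by
    rw [Finset.card_eq_sum_ones]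
    refine Finset.sum_congr rfl fun z hz => ?_
    rw [Finset.mem_filter] at hz
    obtain ⟨⟨hzb, hzi⟩, hzo⟩ := (hmemC z).mp hz.1
    have hz1 : deriv G z = 0 := apply_eq_zero_of_analyticOrderNatAt_ne_zero hzo
    exact analyticOrderNatAt_eq_one_of_simple (hG₁d.analyticAt z) hz1 (hsimple z hzb hzi hz1 hz.2)
  -- (C) the slot injection: `c ↦ #{teeth strictly left of c}` is strictly monotone in `Re c`
  set φ : ℂ → ℕ := fun c => (T.filter (fun t => t.re < c.re)).card with hφ
  have hφmono : ∀ c₁ ∈ C.filter (fun z => ¬ G z = 0), ∀ c₂ ∈ C.filter (fun z => ¬ G z = 0), c₁.re < c₂.re → φ c₁ < φ c₂ := by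
    intro c₁ hc₁ c₂ hc₂ hlt
    rw [Finset.mem_filter] at hc₁ hc₂
    obtain ⟨⟨h1b, h1i⟩, h1o⟩ := (hmemC c₁).mp hc₁.1
    obtain ⟨⟨h2b, h2i⟩, h2o⟩ := (hmemC c₂).mp hc₂.1
    obtain ⟨t, htb, hti, hGt, ht1, ht2⟩ := hslot c₁ c₂ h1b h1i h2b h2i hlt
      (apply_eq_zero_of_analyticOrderNatAt_ne_zero h1o) (apply_eq_zero_of_analyticOrderNatAt_ne_zero h2o) hc₁.2 hc₂.2
    have htT : t ∈ T := (hmemT t).mpr ⟨⟨htb, hti⟩, analyticOrderNatAt_ne_zero_of_entire hG hne hGt⟩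
    have hsub : T.filter (fun t => t.re < c₁.re) ⊆ T.filter (fun t => t.re < c₂.re) := by
      intro u hu
      rw [Finset.mem_filter] at hu ⊢
      exact ⟨hu.1, hu.2.trans hlt⟩
    have hssub : T.filter (fun t => t.re < c₁.re) ⊂ T.filter (fun t => t.re < c₂.re) := by
      rw [Finset.ssubset_iff_of_subset hsub]
      refine ⟨t, Finset.mem_filter.mpr ⟨htT, ht2⟩, fun h => ?_⟩
      have := (Finset.mem_filter.mp h).2
      linarith
    exact Finset.card_lt_card hssub
  have hcard : (C.filter (fun z => ¬ G z = 0)).card ≤ T.card + 1 := by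
    have hmaps : Set.MapsTo φ (↑(C.filter (fun z => ¬ G z = 0)) : Set ℂ) (↑(Finset.range (T.card + 1)) : Set ℕ) := by
      intro c _
      rw [Finset.mem_coe, Finset.mem_range]
      exact Nat.lt_succ_of_le (Finset.card_filter_le _ _)
    have hinj : Set.InjOn φ (↑(C.filter (fun z => ¬ G z = 0)) : Set ℂ) := by
      intro c₁ hc₁ c₂ hc₂ heq
      rw [Finset.mem_coe] at hc₁ hc₂
      rcases lt_trichotomy c₁.re c₂.re with hlt | hre | hgt
      · exact absurd heq (ne_of_lt (hφmono c₁ hc₁ c₂ hc₂ hlt))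
      · have h1i : c₁.im = 0 := ((hmemC c₁).mp (Finset.mem_filter.mp hc₁).1).1.2
        have h2i : c₂.im = 0 := ((hmemC c₂).mp (Finset.mem_filter.mp hc₂).1).1.2
        exact Complex.ext hre (by rw [h1i, h2i])
      · exact absurd heq.symm (ne_of_lt (hφmono c₂ hc₂ c₁ hc₁ hgt))
    have := Finset.card_le_card_of_injOn φ hmaps hinj
    rwa [Finset.card_range] at this
  -- (D) teeth: `Σ_T (ord − 1) + #T = Σ_T ord`
  have hD : (∑ z ∈ T, (analyticOrderNatAt G z - 1)) + T.card = ∑ z ∈ T, analyticOrderNatAt G z := by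
    rw [Finset.card_eq_sum_ones, ← Finset.sum_add_distrib]
    refine Finset.sum_congr rfl fun z hz => ?_
    exact Nat.sub_add_cancel (Nat.one_le_iff_ne_zero.mpr ((hmemT z).mp hz).2)
  rw [hB]
  omega

/-! ## §3 the frame theorem: non-Ready′ supplies both hypotheses -/

/-- ★★★ (K) §3 **THE REAL PIGEONHOLE AT A NON-READY′ LEVEL** (`f` real entire, `f⁽ʲ⁾ ≢ 0`, level `j` not Ready′, slice in range): the real zeros of
`f⁽ʲ⁺¹⁾` in `(a − ρ, a + ρ)`, with multiplicity, number at most those of `f⁽ʲ⁾` plus one — in the currency of C1's `zcountReal`. -/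
theorem realCritBound_of_real {f : ℂ → ℂ} (hf : Differentiable ℂ f) (hreal : ∀ x : ℝ, (f x).im = 0)
    {η x₀ s hmax R Hs : ℝ} {B j : ℕ} {v : ℂ} {a ρ : ℝ}
    (hne : iteratedDeriv j f ≠ 0) (hnr : ¬ ReadyR2 η f x₀ s hmax R Hs B j v) (hrange : |a - x₀| + ρ < ((j : ℝ) + 3) * R / 2) :
    ((∑ᶠ z ∈ ball (a : ℂ) ρ ∩ {z : ℂ | z.im = 0}, analyticOrderNatAt (iteratedDeriv (j + 1) f) z : ℕ) : ℝ)
      ≤ ((∑ᶠ z ∈ ball (a : ℂ) ρ ∩ {z : ℂ | z.im = 0}, analyticOrderNatAt (iteratedDeriv j f) z : ℕ) : ℝ) + 1 := by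
  have hGd : Differentiable ℂ (iteratedDeriv j f) := differentiable_iteratedDeriv_of_entire hf j
  -- dictionary: real points of the slice are in range, and `f⁽ᵏ⁾` is real there
  have hxrange : ∀ c : ℂ, c ∈ ball (a : ℂ) ρ → |c.re - x₀| < ((j : ℝ) + 3) * R / 2 := by
    intro c hc
    rw [mem_ball, dist_eq_norm] at hc
    have h1 : |c.re - a| ≤ ‖c - (a : ℂ)‖ := by
      have := Complex.abs_re_le_norm (c - (a : ℂ))
      simpa using this
    have h2 := abs_sub_le c.re a x₀
    linarith
  have hofRe : ∀ c : ℂ, c.im = 0 → c = ((c.re : ℝ) : ℂ) := fun c hc => Complex.ext (by simp) (by simp [hc])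
  have hrealk : ∀ (k : ℕ) (c : ℂ), c.im = 0 → (iteratedDeriv k f c).im = 0 := by
    intro k c hc
    rw [hofRe c hc]
    exact im_iteratedDeriv_ofReal hf hreal k c.re
  have hzero_of_re : ∀ (k : ℕ) (c : ℂ), c.im = 0 → (iteratedDeriv k f c).re = 0 → iteratedDeriv k f c = 0 :=
    fun k c hc hre => Complex.ext (by simpa using hre) (by simpa using hrealk k c hc)
  suffices h : (∑ᶠ z ∈ ball (a : ℂ) ρ ∩ {z : ℂ | z.im = 0}, analyticOrderNatAt (iteratedDeriv (j + 1) f) z)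
      ≤ (∑ᶠ z ∈ ball (a : ℂ) ρ ∩ {z : ℂ | z.im = 0}, analyticOrderNatAt (iteratedDeriv j f) z) + 1 by exact_mod_cast h
  rw [iteratedDeriv_succ]
  refine finsum_order_deriv_le hGd hne ?_ ?_
  · -- (slot) two off-teeth real critical points in range with no tooth between would make level `j` Ready′
    intro c₁ c₂ h1b h1i h2b h2i hlt hd1 hd2 hG1 hG2
    by_contra hcon
    push Not at hcon
    apply hnr
    refine readyR2_of_two_crit hf η x₀ s hmax R Hs B j v hlt (hxrange c₁ h1b) (hxrange c₂ h2b) ?_ ?_ ?_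
    · rw [iteratedDeriv_succ, ← hofRe c₁ h1i, hd1, Complex.zero_re]
    · rw [iteratedDeriv_succ, ← hofRe c₂ h2i, hd2, Complex.zero_re]
    · intro x hx hx0
      have hGx : iteratedDeriv j f (x : ℂ) = 0 := hzero_of_re j (x : ℂ) (Complex.ofReal_im x) hx0
      rcases hx.1.eq_or_lt with h | h
      · apply hG1
        rw [hofRe c₁ h1i, h]
        exact hGx
      rcases hx.2.eq_or_lt with h' | h'
      · apply hG2
        rw [hofRe c₂ h2i, ← h']
        exact hGx
      have hxb : ((x : ℝ) : ℂ) ∈ ball (a : ℂ) ρ := by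
        rw [mem_ball, dist_eq_norm] at h1b h2b ⊢
        have e1 : |c₁.re - a| ≤ ‖c₁ - (a : ℂ)‖ := by simpa using Complex.abs_re_le_norm (c₁ - (a : ℂ))
        have e2 : |c₂.re - a| ≤ ‖c₂ - (a : ℂ)‖ := by simpa using Complex.abs_re_le_norm (c₂ - (a : ℂ))
        rw [← Complex.ofReal_sub, Complex.norm_real, Real.norm_eq_abs, abs_lt]
        constructor
        · linarith [(abs_lt.mp (lt_of_le_of_lt e1 h1b)).1]
        · linarith [(abs_lt.mp (lt_of_le_of_lt e2 h2b)).2]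
      have := hcon (x : ℂ) hxb (Complex.ofReal_im x) hGx (by simpa using h)
      simp at this
      linarith
  · -- (simple) an off-tooth real critical point with `G″ = 0` would be an NL event `0 ≤ G·G″` in range
    intro c hcb hci hd1 hG0 hd2
    apply hnr
    have hx := hxrange c hcb
    have h1 : (iteratedDeriv (j + 1) f ((c.re : ℝ) : ℂ)).re = 0 := by
      rw [iteratedDeriv_succ, ← hofRe c hci, hd1, Complex.zero_re]
    have h0 : (iteratedDeriv j f ((c.re : ℝ) : ℂ)).re ≠ 0 := by
      intro h
      exact hG0 (by rw [hofRe c hci]; exact hzero_of_re j _ (Complex.ofReal_im c.re) h)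
    have h2 : (iteratedDeriv (j + 2) f ((c.re : ℝ) : ℂ)).re = 0 := by
      rw [iteratedDeriv_succ, iteratedDeriv_succ, ← hofRe c hci, hd2, Complex.zero_re]
    exact ⟨j, le_rfl, Or.inr ⟨c.re, hx, h1, h0, by rw [h2, mul_zero]⟩⟩

/-- ★★★ (K) §3 … on a legal frame (`EngineHyps5` supplies `f` entire and real): the body of C1's `RealCritBoundSig`, literally. -/
theorem realCritBound {η : ℝ} {f : ℂ → ℂ} {x₀ s hmax R Hs : ℝ} {B : ℕ} (hE : EngineHyps5 2 η f x₀ s hmax R Hs B)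
    {j : ℕ} {v : ℂ} {a ρ : ℝ} (hne : iteratedDeriv j f ≠ 0) (hnr : ¬ ReadyR2 η f x₀ s hmax R Hs B j v)
    (hrange : |a - x₀| + ρ < ((j : ℝ) + 3) * R / 2) :
    ((∑ᶠ z ∈ Metric.ball (a : ℂ) ρ ∩ {z : ℂ | z.im = 0}, analyticOrderNatAt (iteratedDeriv (j + 1) f) z : ℕ) : ℝ)
      ≤ ((∑ᶠ z ∈ Metric.ball (a : ℂ) ρ ∩ {z : ℂ | z.im = 0}, analyticOrderNatAt (iteratedDeriv j f) z : ℕ) : ℝ) + 1 :=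
  realCritBound_of_real hE.1 hE.2.1 hne hnr hrange

/-- ★★★ (K) §3 the socket in its universally quantified shape (token-identical to the BODY of `RhW08.ClusterQ.RealCritBoundSig` with `zcountReal` unfolded). -/
theorem realCritBound_all :
    ∀ (η : ℝ) (f : ℂ → ℂ) (x₀ s hmax R Hs : ℝ) (B : ℕ), EngineHyps5 2 η f x₀ s hmax R Hs B →
      ∀ (j : ℕ) (v : ℂ) (a ρ : ℝ), iteratedDeriv j f ≠ 0 → ¬ ReadyR2 η f x₀ s hmax R Hs B j v →
        |a - x₀| + ρ < ((j : ℝ) + 3) * R / 2 →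
        ((∑ᶠ z ∈ Metric.ball (a : ℂ) ρ ∩ {z : ℂ | z.im = 0}, analyticOrderNatAt (iteratedDeriv (j + 1) f) z : ℕ) : ℝ)
          ≤ ((∑ᶠ z ∈ Metric.ball (a : ℂ) ρ ∩ {z : ℂ | z.im = 0}, analyticOrderNatAt (iteratedDeriv j f) z : ℕ) : ℝ) + 1 :=
  fun _ _ _ _ _ _ _ _ hE _ _ _ _ hne hnr hr => realCritBound hE hne hnr hr

/-! ## §4 Bridges to the tree currency (`RhW08.ClusterQ.zcount` / `zcountReal`, #R3ClusterQ = ClusterQ-v1) and the socket closed by name -/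

/-- (K) §4 for an entire `g`, the `ℕ`-order has finite support on any subset of a closed disc (empty support if `g ≡ 0`). -/
theorem finite_inter_support_orderNat {g : ℂ → ℂ} (hg : Differentiable ℂ g) {S : Set ℂ} {c : ℂ} {ρ : ℝ} (hS : S ⊆ closedBall c ρ) :
    (S ∩ Function.support (analyticOrderNatAt g)).Finite := by
  by_cases hg0 : g = 0
  · have h0 : Function.support (analyticOrderNatAt g) = ∅ := by
      ext z
      have : analyticOrderAt g z = ⊤ := analyticOrderAt_eq_top.mpr (Filter.Eventually.of_forall fun w => by rw [hg0]; rfl)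
      simp [analyticOrderNatAt, this]
    rw [h0, Set.inter_empty]
    exact Set.finite_empty
  · refine (finite_zeros_closedBall_of_entire hg hg0 c ρ).subset ?_
    intro u hu
    exact ⟨hS hu.1, apply_eq_zero_of_analyticOrderNatAt_ne_zero hu.2⟩

/-- (K) §4 **CAST BRIDGE**: on a set where the `ℕ`-order of `g` has finite support, the `ℝ`-valued finsum of `(analyticOrderAt g u).toNat` equals the cast of the
`ℕ`-valued finsum of `analyticOrderNatAt g`. -/
theorem finsum_toNat_eq_cast (g : ℂ → ℂ) (S : Set ℂ) (hS : (S ∩ Function.support (analyticOrderNatAt g)).Finite) :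
    ∑ᶠ u ∈ S, ((analyticOrderAt g u).toNat : ℝ) = ((∑ᶠ z ∈ S, analyticOrderNatAt g z : ℕ) : ℝ) := by
  change ∑ᶠ u ∈ S, ((analyticOrderNatAt g u : ℕ) : ℝ) = _
  have hsupp : Function.support (fun u => ((analyticOrderNatAt g u : ℕ) : ℝ)) = Function.support (analyticOrderNatAt g) := by
    ext u
    simp [Function.mem_support]
  calc ∑ᶠ u ∈ S, ((analyticOrderNatAt g u : ℕ) : ℝ)
      = ∑ᶠ u ∈ S ∩ Function.support (fun u => ((analyticOrderNatAt g u : ℕ) : ℝ)), ((analyticOrderNatAt g u : ℕ) : ℝ) :=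
        (finsum_mem_inter_support (fun u => ((analyticOrderNatAt g u : ℕ) : ℝ)) S).symm
    _ = ∑ᶠ u ∈ S ∩ Function.support (analyticOrderNatAt g), ((analyticOrderNatAt g u : ℕ) : ℝ) := by rw [hsupp]
    _ = ((∑ᶠ u ∈ S ∩ Function.support (analyticOrderNatAt g), analyticOrderNatAt g u : ℕ) : ℝ) :=
        (Nat.cast_finsum_mem hS (analyticOrderNatAt g)).symm
    _ = ((∑ᶠ z ∈ S, analyticOrderNatAt g z : ℕ) : ℝ) := by rw [finsum_mem_inter_support]

/-- ★ (K) §4 **CURRENCY BRIDGE, all zeros**: for entire `g`, the tree's `zcount g a ρ` equals the Literature-Rouché currency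
`↑(∑ᶠ z ∈ ball a ρ, analyticOrderNatAt g z)`. -/
theorem zcount_eq_finsum {g : ℂ → ℂ} (hg : Differentiable ℂ g) (a ρ : ℝ) :
    RhW08.ClusterQ.zcount g a ρ = ((∑ᶠ z ∈ ball (a : ℂ) ρ, analyticOrderNatAt g z : ℕ) : ℝ) := by
  have hset : {u : ℂ | g u = 0 ∧ ‖u - (a : ℂ)‖ < ρ} ∩ Function.support (fun u => ((analyticOrderAt g u).toNat : ℝ))
      = ball (a : ℂ) ρ ∩ Function.support (fun u => ((analyticOrderAt g u).toNat : ℝ)) := by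
    ext u
    simp only [Set.mem_inter_iff, Set.mem_setOf_eq, Function.mem_support, Metric.mem_ball, dist_eq_norm]
    constructor
    · rintro ⟨⟨-, hn⟩, hF⟩
      exact ⟨hn, hF⟩
    · rintro ⟨hn, hF⟩
      refine ⟨⟨?_, hn⟩, hF⟩
      have hF' : analyticOrderNatAt g u ≠ 0 := by exact_mod_cast hF
      exact apply_eq_zero_of_analyticOrderNatAt_ne_zero hF'
  unfold RhW08.ClusterQ.zcount
  calc ∑ᶠ u ∈ {u : ℂ | g u = 0 ∧ ‖u - (a : ℂ)‖ < ρ}, ((analyticOrderAt g u).toNat : ℝ)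
      = ∑ᶠ u ∈ {u : ℂ | g u = 0 ∧ ‖u - (a : ℂ)‖ < ρ} ∩ Function.support (fun u => ((analyticOrderAt g u).toNat : ℝ)),
          ((analyticOrderAt g u).toNat : ℝ) := (finsum_mem_inter_support (fun u => ((analyticOrderAt g u).toNat : ℝ)) _).symm
    _ = ∑ᶠ u ∈ ball (a : ℂ) ρ ∩ Function.support (fun u => ((analyticOrderAt g u).toNat : ℝ)), ((analyticOrderAt g u).toNat : ℝ) := by
          rw [hset]
    _ = ∑ᶠ u ∈ ball (a : ℂ) ρ, ((analyticOrderAt g u).toNat : ℝ) := finsum_mem_inter_support (fun u => ((analyticOrderAt g u).toNat : ℝ)) _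
    _ = ((∑ᶠ z ∈ ball (a : ℂ) ρ, analyticOrderNatAt g z : ℕ) : ℝ) :=
          finsum_toNat_eq_cast g _ (finite_inter_support_orderNat hg (subset_refl _ |>.trans ball_subset_closedBall))

/-- ★ (K) §4 **CURRENCY BRIDGE, real zeros**: for entire `g`, the tree's `zcountReal g a ρ` equals `↑(∑ᶠ z ∈ ball a ρ ∩ {Im z = 0}, analyticOrderNatAt g z)`. -/
theorem zcountReal_eq_finsum {g : ℂ → ℂ} (hg : Differentiable ℂ g) (a ρ : ℝ) :
    RhW08.ClusterQ.zcountReal g a ρ = ((∑ᶠ z ∈ ball (a : ℂ) ρ ∩ {z : ℂ | z.im = 0}, analyticOrderNatAt g z : ℕ) : ℝ) := by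
  have hset : {u : ℂ | g u = 0 ∧ ‖u - (a : ℂ)‖ < ρ ∧ u.im = 0} ∩ Function.support (fun u => ((analyticOrderAt g u).toNat : ℝ))
      = (ball (a : ℂ) ρ ∩ {z : ℂ | z.im = 0}) ∩ Function.support (fun u => ((analyticOrderAt g u).toNat : ℝ)) := by
    ext u
    simp only [Set.mem_inter_iff, Set.mem_setOf_eq, Function.mem_support, Metric.mem_ball, dist_eq_norm]
    constructor
    · rintro ⟨⟨-, hn, hi⟩, hF⟩
      exact ⟨⟨hn, hi⟩, hF⟩
    · rintro ⟨⟨hn, hi⟩, hF⟩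
      refine ⟨⟨?_, hn, hi⟩, hF⟩
      have hF' : analyticOrderNatAt g u ≠ 0 := by exact_mod_cast hF
      exact apply_eq_zero_of_analyticOrderNatAt_ne_zero hF'
  unfold RhW08.ClusterQ.zcountReal
  calc ∑ᶠ u ∈ {u : ℂ | g u = 0 ∧ ‖u - (a : ℂ)‖ < ρ ∧ u.im = 0}, ((analyticOrderAt g u).toNat : ℝ)
      = ∑ᶠ u ∈ {u : ℂ | g u = 0 ∧ ‖u - (a : ℂ)‖ < ρ ∧ u.im = 0} ∩ Function.support (fun u => ((analyticOrderAt g u).toNat : ℝ)),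
          ((analyticOrderAt g u).toNat : ℝ) := (finsum_mem_inter_support (fun u => ((analyticOrderAt g u).toNat : ℝ)) _).symm
    _ = ∑ᶠ u ∈ (ball (a : ℂ) ρ ∩ {z : ℂ | z.im = 0}) ∩ Function.support (fun u => ((analyticOrderAt g u).toNat : ℝ)),
          ((analyticOrderAt g u).toNat : ℝ) := by rw [hset]
    _ = ∑ᶠ u ∈ ball (a : ℂ) ρ ∩ {z : ℂ | z.im = 0}, ((analyticOrderAt g u).toNat : ℝ) :=
          finsum_mem_inter_support (fun u => ((analyticOrderAt g u).toNat : ℝ)) _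
    _ = ((∑ᶠ z ∈ ball (a : ℂ) ρ ∩ {z : ℂ | z.im = 0}, analyticOrderNatAt g z : ℕ) : ℝ) :=
          finsum_toNat_eq_cast g _ (finite_inter_support_orderNat hg (fun u hu => ball_subset_closedBall hu.1))

/-- ★★★ (K) §4 **THE TREE SOCKET, CLOSED BY NAME**: `RhW08.ClusterQ.RealCritBoundSig` (#R3ClusterQ l.133) holds. -/
theorem realCritBoundSig_holds : RhW08.ClusterQ.RealCritBoundSig := by
  intro η f x₀ s hmax R Hs B hE j v a ρ hne hnr hr
  have hf : Differentiable ℂ f := hE.1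
  rw [zcountReal_eq_finsum (differentiable_iteratedDeriv_of_entire hf (j + 1)) a ρ,
    zcountReal_eq_finsum (differentiable_iteratedDeriv_of_entire hf j) a ρ]
  exact realCritBound hE hne hnr hr

/-- ★★ (K) §4 **THE CLUSTER DOOR MODULO THE COUNT SOCKET**: `ClusterCountSig → ClusterLawQ` (tree `clusterLawQ_of_count_realBound` with the real bound discharged);
the count socket (Rouché + Gauss–Lucas, `m − 1` critical points of a dominated degree-`m` cluster) is C1's v2 §6 / C3's Dominated kernel, to be landed over
the tree currency via `zcount_eq_finsum`. -/
theorem clusterLawQ_of_count (hC : RhW08.ClusterQ.ClusterCountSig) : RhW08.ClusterQ.ClusterLawQ :=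
  RhW08.ClusterQ.clusterLawQ_of_count_realBound hC realCritBoundSig_holds

end RhW08.RealCrit
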